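import Literature.Geometry.Riemannian.HCenterLocationRicciBound
import Literature.Geometry.Riemannian.RicciFlowLengthDistortion
import Literature.Geometry.Riemannian.ParabolicNhdSliceVolume
import HarnessLib

/-!
# Conventional parabolic neighbourhoods lie in `P*`-parabolic neighbourhoods under a local
# two-sided Ricci bound (Bamler 2020a, Cor. 9.6 (a); arXiv v1 Cor. 34 (a))

R. Bamler, *Entropy and heat kernel bounds on a Ricci flow background*, arXiv:2008.07093 (2020a),
§9.1: the conventional parabolic neighbourhood is
`P(x₀, t₀; A, −T⁻, T⁺) = B(x₀, t₀, A) × ([t₀ − T⁻, t₀ + T⁺] ∩ I)` ((9.1)), the `P*`-parabolic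
neighbourhood `P*(x₀, t₀; A, −T⁻, T⁺)` is the set of `(x, t)`, `t ∈ [t₀ − T⁻, t₀ + T⁺]`, with
`d^{g_{t₀−T⁻}}_{W₁}(ν_{x₀,t₀;t₀−T⁻}, ν_{x,t;t₀−T⁻}) < A` (Def. 9.1), and Cor. 9.6 (a) states
`P(x₀, t₀; A r, −T⁻r², T⁺r²) ⊂ P*(x₀, t₀; A′ r, −T⁻r², T⁺r²)` for
`A′ ≥ A̲′(A, K, T^±)` if `|Ric| ≤ K r⁻²` on the conventional neighbourhood; proof (§9.2): "follows
directly from Proposition 9.5 and a standard distance distortion estimate".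

This file proves the statement in the tree's metric-flow vocabulary
(`ricciFlowMetricFlow`, `MetricFlow.pParabolicNhd`) in the SLACK form in which the curvature bound
is assumed on the conventional neighbourhood of DOUBLE radius `B(x₀, t₀, 2A r) × [t₀ − T⁻r²,
t₀ + T⁺r²]` (which is what the distance distortion argument uses, and which suffices for §10):

* `wassersteinW1_condKernel_dirac_le_of_ricci_bound` — Prop. 9.5 in `W₁`-form: under the
  hypotheses of `exists_edist_hCenter_le_of_ricci_bound`,
  `d_{W₁}^{t₁}(ν_{x,t;t₁}, δ_x) ≤ (√H_m + C) √(t − t₁)` (an `H_m`-centre `z` of `(x, t)`,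
  `d_{W₁}(ν, δ_z) ≤ √(H_m (t − t₁))`, and `d_{t₁}(z, x) ≤ C √(t − t₁)`);
* `exists_mem_pParabolicNhd_of_ricci_bound` — **Cor. 9.6 (a)**: for `m ≥ 3`, `A, K, T^± ≥ 0`
  there is `A′ = A′(m, A, K, T^±) > 0` such that for every compact Ricci flow, `x₀, t₀`, `r > 0`
  with `a < t₀ − T⁻r²`, if `|Ric_s| ≤ K r⁻² g_s` at all `(y, s)` with `d_{t₀}(x₀, y) < 2A r`,
  `s ∈ [t₀ − T⁻r², t₀ + T⁺r²] ∩ [a, T]`, then every `(x, t)` with `t ∈ [t₀ − T⁻r², t₀ + T⁺r²]`,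
  `d_{t₀}(x₀, x) < A r` lies in `P*(x₀, t₀; A′ r, −T⁻r², T⁺r²)`. Proof as in the source: with
  `s₀ = t₀ − T⁻r²`,
  `d_{W₁}(ν_{x₀,t₀;s₀}, ν_{x,t;s₀}) ≤ d_{W₁}(ν_{x₀,t₀;s₀}, δ_{x₀}) + d_{s₀}(x₀, x)`
  `+ d_{W₁}(δ_x, ν_{x,t;s₀})`;
  the outer terms by Prop. 9.5 at `(x₀, t₀)` and at `(x, t)` — the `g_{t′}`-balls of radius
  `α √(t − s₀)` around `x₀`, `x` lie in `B(x₀, t₀, 2A r)` by the local distance distortion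
  `edist_le_exp_mul_edist_of_ricci_bound_ball_rev` for `α = A e^{−K(T⁻+T⁺)}/(1 + √(T⁻+T⁺))` —
  and the middle term by `IsRicciFlow.edist_le_exp_mul_edist_of_ricci_bound_ball`:
  `d_{s₀}(x₀, x) ≤ e^{K(T⁻+T⁺)} d_{t₀}(x₀, x)`.

Everything is proved; no definitions, no named facts. What is NOT here: part (b) of Cor. 9.6
(`P* ⊂ P`, a continuity argument in time) and the sharp (single radius) form of (a).

## References

* R. H. Bamler, *Entropy and heat kernel bounds on a Ricci flow background*, arXiv:2008.07093
  (2020), §9.1, (9.1), Def. 9.1, Prop. 9.5, Cor. 9.6 (arXiv v1: Prop. 33, Cor. 34); §9.2, proofs.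
  [Bamler2020Entropy]
* R. H. Bamler, *Compactness theory of the space of super Ricci flows*, Invent. Math. 233 (2023),
  §3.4 (`H`-centres), §3.5 (`P*`-parabolic neighbourhoods). [Bamler2023]
-/

noncomputable section

open Set Filter Function MeasureTheory Measure
open scoped Manifold ContDiff Topology ENNReal NNReal

namespace Literature.Geometry.Riemannian

open Lorentzian Lorentzian.PseudoRiemannianMetric MetricFlow

universe u

section Flow

variable {m : ℕ} {M : Type u} [TopologicalSpace M] [ChartedSpace (EuclideanSpace ℝ (Fin m)) M]
  [IsManifold 𝓘(ℝ, EuclideanSpace ℝ (Fin m)) ∞ M] [T2Space M] [CompactSpace M]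
  [SecondCountableTopology M] [MeasurableSpace M] [BorelSpace M] [ConnectedSpace M] [T3Space M]
  {h : ℝ → PseudoRiemannianMetric 𝓘(ℝ, EuclideanSpace ℝ (Fin m)) ∞ (EuclideanSpace ℝ (Fin m))
    (TangentSpace 𝓘(ℝ, EuclideanSpace ℝ (Fin m)) : M → Type _)}
  {cov : ℝ → CovariantDerivative 𝓘(ℝ, EuclideanSpace ℝ (Fin m)) (EuclideanSpace ℝ (Fin m))
    (TangentSpace 𝓘(ℝ, EuclideanSpace ℝ (Fin m)) : M → Type _)}
  {a T : ℝ}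

omit [T3Space M] in
/-- **Prop. 9.5 in `W₁`-form** (Bamler 2020a, Prop. 9.5 / arXiv v1 Prop. 33:
`d_{W₁}^{g_{t₀−r²}}(ν_{x₀,t₀;t₀−r²}, δ_{x₀}) ≤ C(α, K) r`): if `C` is a constant as provided by
`exists_edist_hCenter_le_of_ricci_bound` (every `H_m`-centre `(z, t₁)` of `(x, t)` has
`d_{t₁}(x, z) ≤ C √(t − t₁)`), then in the metric flow of the Ricci flow
`d_{W₁}(ν_{x,t;t₁}, δ_x) ≤ (√H_m + C) √Θ r` whenever `t − t₁ ≤ Θ r²`: for `t₁ = t` the kernel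
is `δ_x`; for `t₁ < t` take an `H_m`-centre `z` (`IsHConcentrated.exists_isHCenter`,
`ricciFlowMetricFlow_isHConcentrated`), `d_{W₁}(ν, δ_z) ≤ √(H_m (t − t₁))` and
`d_{W₁}(δ_z, δ_x) = d_{t₁}(z, x) ≤ C √(t − t₁)`.
[cite: Bamler2020Entropy, §9.2, proof of Prop. 9.5 (arXiv v1 Prop. 33), last display] -/
theorem wassersteinW1_condKernel_dirac_le_of_ricci_bound (hm : 3 ≤ m)
    (hflow : IsRicciFlow h cov (Icc a T)) (hh : IsContMDiffFamilyOn ∞ h univ)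
    (hR : ∀ r, (h r).IsRiemannian) {C : ℝ} (hC : 0 ≤ C) {t₁ t : ℝ} (ht₁ : t₁ ∈ Icc a T)
    (ht : t ∈ Icc a T) (h1t : t₁ ≤ t) {Θ r : ℝ} (hΘ : 0 ≤ Θ) (hr : 0 ≤ r)
    (hτ : t - t₁ ≤ Θ * r ^ 2) (x : M)
    (hloc : t₁ < t → ∀ z : M,
      ∫⁻ w, (h t₁).edist (hR t₁) z w ^ 2 ∂(heatKernelMeasure hh hR t x t₁) ≤
        ENNReal.ofReal ((((m : ℝ) - 1) * Real.pi ^ 2 / 2 + 4) * (t - t₁)) →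
      ((h t₁).edist (hR t₁) x z).toReal ≤ C * Real.sqrt (t - t₁)) :
    wassersteinW1 ((ricciFlowMetricFlow hh hR Set.ordConnected_Icc hflow).condKernel
        (t := ⟨t, ht⟩) x ⟨t₁, ht₁⟩)
      (Measure.dirac x : Measure ((ricciFlowMetricFlow hh hR Set.ordConnected_Icc hflow).Slice
        ⟨t₁, ht₁⟩)) ≤
      ENNReal.ofReal ((Real.sqrt (MetricFlow.concentrationConst m) + C) * Real.sqrt Θ * r) := by
  set 𝒳 : MetricFlow (Icc a T) := ricciFlowMetricFlow hh hR Set.ordConnected_Icc hflow with h𝒳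
  have hmpos : 0 < m := lt_of_lt_of_le (by norm_num) hm
  have hHm0 : 0 ≤ MetricFlow.concentrationConst m := by
    have h3 : (3 : ℝ) ≤ m := by exact_mod_cast hm
    have h1 : 0 ≤ ((m : ℝ) - 1) * Real.pi ^ 2 / 2 :=
      div_nonneg (mul_nonneg (by linarith only [h3]) (sq_nonneg _)) zero_le_two
    rw [MetricFlow.concentrationConst]
    linarith only [h1]
  have hle : ((⟨t₁, ht₁⟩ : Icc a T) : ℝ) ≤ (⟨t, ht⟩ : Icc a T) := h1t
  haveI := 𝒳.isProbabilityMeasure_condKernel (s := ⟨t₁, ht₁⟩) (t := ⟨t, ht⟩) x hle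
  rcases h1t.eq_or_lt with heq | hlt
  · -- `t₁ = t`: the kernel is `δ_x`
    have hker : 𝒳.condKernel (t := ⟨t, ht⟩) x ⟨t₁, ht₁⟩ =
        (Measure.dirac x : Measure (𝒳.Slice ⟨t₁, ht₁⟩)) := by
      show heatKernelMeasure hh hR t x t₁ = Measure.dirac x
      exact heatKernelMeasure_of_le hh hR heq.ge x
    rw [hker, wassersteinW1_self]
    exact zero_le
  have hH : 𝒳.IsHConcentrated (MetricFlow.concentrationConst m) :=
    ricciFlowMetricFlow_isHConcentrated hmpos hh hR _ hflow
  obtain ⟨z, hz⟩ := hH.exists_isHCenter (s := ⟨t₁, ht₁⟩) (t := ⟨t, ht⟩) hle x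
  have hτ0 : 0 ≤ t - t₁ := sub_nonneg.2 h1t
  have hsq : Real.sqrt (t - t₁) ≤ Real.sqrt Θ * r := by
    rw [← Real.sqrt_sq hr, ← Real.sqrt_mul hΘ]
    exact Real.sqrt_le_sqrt hτ
  have hc0 : 0 ≤ Real.sqrt (MetricFlow.concentrationConst m) + C :=
    add_nonneg (Real.sqrt_nonneg _) hC
  -- `d_{t₁}(x, z) ≤ C √(t − t₁)`
  have hdz : ((h t₁).edist (hR t₁) x z).toReal ≤ C * Real.sqrt (t - t₁) :=
    hloc hlt z hz.lintegral_edist_sq_le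
  have hdz' : @edist (𝒳.Slice ⟨t₁, ht₁⟩) _ z x ≤ ENNReal.ofReal (C * Real.sqrt (t - t₁)) := by
    rw [PseudoEMetricSpace.edist_comm]
    show (h t₁).edist (hR t₁) x z ≤ _
    exact (ENNReal.le_ofReal_iff_toReal_le (PseudoRiemannianMetric.edist_ne_top (hR t₁) x z)
      (mul_nonneg hC (Real.sqrt_nonneg _))).2 hdz
  calc wassersteinW1 (𝒳.condKernel (t := ⟨t, ht⟩) x ⟨t₁, ht₁⟩) (Measure.dirac x)
      ≤ wassersteinW1 (𝒳.condKernel (t := ⟨t, ht⟩) x ⟨t₁, ht₁⟩) (Measure.dirac z) +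
          wassersteinW1 (Measure.dirac z) (Measure.dirac x) := wassersteinW1_triangle _ _ _
    _ ≤ ENNReal.ofReal (Real.sqrt (MetricFlow.concentrationConst m) * Real.sqrt (t - t₁)) +
          ENNReal.ofReal (C * Real.sqrt (t - t₁)) := by
        refine add_le_add ?_ ?_
        · rw [wassersteinW1_comm]
          refine hz.wassersteinW1_dirac_le.trans ?_
          have := ofReal_mul_rpow_half_le_ofReal_sqrt_mul (H := MetricFlow.concentrationConst m)
            (τ := t - t₁) (Θ := 1) (ρ := Real.sqrt (t - t₁)) hHm0 hτ0 (Real.sqrt_nonneg _)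
            (by rw [Real.sq_sqrt hτ0, one_mul])
          rwa [mul_one] at this
        · rw [wassersteinW1_dirac_dirac]
          exact hdz'
    _ = ENNReal.ofReal ((Real.sqrt (MetricFlow.concentrationConst m) + C) *
          Real.sqrt (t - t₁)) := by
        rw [← ENNReal.ofReal_add (mul_nonneg (Real.sqrt_nonneg _) (Real.sqrt_nonneg _))
          (mul_nonneg hC (Real.sqrt_nonneg _)), ← add_mul]
    _ ≤ ENNReal.ofReal ((Real.sqrt (MetricFlow.concentrationConst m) + C) * Real.sqrt Θ * r) := by
        refine ENNReal.ofReal_le_ofReal ?_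
        rw [mul_assoc]
        exact mul_le_mul_of_nonneg_left hsq hc0

omit [T2Space M] [CompactSpace M] [SecondCountableTopology M] [MeasurableSpace M] [BorelSpace M]
  [ConnectedSpace M] in
/-- **The curvature hypothesis of Prop. 9.5 from the curvature bound on a `g_{t₀}`-ball**
(Bamler 2020a, §9.2, proof of Cor. 9.6: "a standard distance distortion estimate"): if
`|Ric_τ| ≤ (K/r²) g_τ` on `B_{t₀}(p, A r)` for `τ ∈ J = [s₀, s₂] ∋ t₀`, `|J| ≤ Θ r²`,
`e^{(K/r²)|J|} ≤ L` and `L α √Θ < A`, then for `t′ ∈ J`, `t′ > s₀`, the `g_{t″}`-balls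
`B_{t″}(p, α √(t′ − s₀))`, `t″ ∈ [s₀, t′]`, lie in `B_{t₀}(p, A r)`
(`edist_le_exp_mul_edist_of_ricci_bound_ball_rev`), so that
`|Ric_{t″}| ≤ K(Θ + 1)/(t′ − s₀) g_{t″}` there.
[cite: Bamler2020Entropy, §9.2, proof of Cor. 9.6] -/
theorem ricci_bound_parabolic_of_ricci_bound_ball (hflow : IsRicciFlow h cov (Icc a T))
    (hR : ∀ r, (h r).IsRiemannian) {s₀ s₂ t₀ : ℝ} (hJ : Icc s₀ s₂ ⊆ Icc a T)
    (ht₀J : t₀ ∈ Icc s₀ s₂) {K r Θ L α A : ℝ} (hK : 0 ≤ K) (hr : 0 < r) (hΘ0 : 0 ≤ Θ)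
    (hJΘ : s₂ - s₀ ≤ Θ * r ^ 2) (hkL : Real.exp (K / r ^ 2 * (s₂ - s₀)) ≤ L) (hα : 0 < α)
    (hαL : L * α * Real.sqrt Θ < A) (p : M)
    (hRicp : ∀ τ ∈ Icc s₀ s₂, ∀ y : M, (h t₀).edist (hR t₀) p y < ENNReal.ofReal (A * r) →
      ∀ X : TangentSpace 𝓘(ℝ, EuclideanSpace ℝ (Fin m)) y,
        |(cov τ).ricci y X X| ≤ K / r ^ 2 * (h τ).val y X X)
    {t' : ℝ} (ht' : t' ∈ Icc s₀ s₂) (hst' : s₀ < t') :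
    ∀ t'' ∈ Icc s₀ t', ∀ y : M,
      (h t'').edist (hR t'') p y < ENNReal.ofReal (α * Real.sqrt (t' - s₀)) →
      ∀ v : TangentSpace 𝓘(ℝ, EuclideanSpace ℝ (Fin m)) y,
        |(cov t'').ricci y v v| ≤ K * (Θ + 1) / (t' - s₀) * (h t'').val y v v := by
  intro t'' ht'' y hy v
  have hr2 : 0 < r ^ 2 := pow_pos hr 2
  have hK₁ : 0 ≤ K / r ^ 2 := div_nonneg hK hr2.le
  have ht''J : t'' ∈ Icc s₀ s₂ := ⟨ht''.1, ht''.2.trans ht'.2⟩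
  have hτ' : t' - s₀ ≤ Θ * r ^ 2 := by linarith [ht'.2, hJΘ]
  have hL0 : 0 ≤ L := (Real.exp_pos _).le.trans hkL
  -- `d_{t₀}(p, y) < A r` by the backward distortion
  have hsq : Real.sqrt (t' - s₀) ≤ Real.sqrt Θ * r := by
    rw [← Real.sqrt_sq hr.le, ← Real.sqrt_mul hΘ0]
    exact Real.sqrt_le_sqrt hτ'
  set k : ℝ≥0∞ := ENNReal.ofReal (Real.exp (K / r ^ 2 * (s₂ - s₀))) with hk
  have hy' : k * (h t'').edist (hR t'') p y < ENNReal.ofReal (A * r) :=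
    calc k * (h t'').edist (hR t'') p y
        ≤ ENNReal.ofReal L * ENNReal.ofReal (α * Real.sqrt (t' - s₀)) :=
          mul_le_mul' (ENNReal.ofReal_le_ofReal hkL) hy.le
      _ = ENNReal.ofReal (L * (α * Real.sqrt (t' - s₀))) := (ENNReal.ofReal_mul hL0).symm
      _ < ENNReal.ofReal (A * r) := by
          refine (ENNReal.ofReal_lt_ofReal_iff (mul_pos (hαL.trans_le' ?_) hr)).2 ?_
          · exact mul_nonneg (mul_nonneg hL0 hα.le) (Real.sqrt_nonneg _)
          calc L * (α * Real.sqrt (t' - s₀)) ≤ L * (α * (Real.sqrt Θ * r)) :=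
                mul_le_mul_of_nonneg_left (mul_le_mul_of_nonneg_left hsq hα.le) hL0
            _ = L * α * Real.sqrt Θ * r := by ring
            _ < A * r := mul_lt_mul_of_pos_right hαL hr
  have hball : (h t₀).edist (hR t₀) p y < ENNReal.ofReal (A * r) :=
    (edist_le_exp_mul_edist_of_ricci_bound_ball_rev hflow hR hJ hK₁ ht₀J p hRicp ht''J
      hy').trans_lt hy'
  have h1 := hRicp t'' ht''J y hball v
  -- `K/r² ≤ K(Θ+1)/(t' − s₀)`
  have hcoef : K / r ^ 2 ≤ K * (Θ + 1) / (t' - s₀) := by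
    rw [div_le_div_iff₀ hr2 (sub_pos.2 hst')]
    nlinarith [hτ', hK, hr2]
  have hval : 0 ≤ (h t'').val y v v := by
    by_cases hv : v = 0
    · subst hv; simp
    · exact (hR t'' y v hv).le
  exact h1.trans (mul_le_mul_of_nonneg_right hcoef hval)

end Flow

/-- **Conventional parabolic neighbourhoods lie in `P*`-parabolic neighbourhoods under a local
two-sided Ricci bound** (Bamler 2020a, Cor. 9.6 (a); arXiv v1 Cor. 34 (a)), slack form with the
curvature bound on the conventional neighbourhood of double radius: for `m ≥ 3` and
`A, K, T⁻, T⁺ ≥ 0` there is `A′ > 0` such that for every Ricci flow `(h, cov)` on `[a, T]` of a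
smooth family of Riemannian metrics on a closed connected `m`-manifold (metric flow
`𝒳 = ricciFlowMetricFlow hh hR _ hflow`), all `x₀`, `t₀ ∈ [a, T]`, `r > 0` with
`a < t₀ − T⁻r²`, if `|Ric_s(y)| ≤ (K/r²) g_s(y)` whenever `d_{t₀}(x₀, y) < 2A r` and
`s ∈ [t₀ − T⁻r², t₀ + T⁺r²]`, `s ≤ T`, then every `(x, t)` with `t ∈ [a, T]`,
`t₀ − T⁻r² ≤ t ≤ t₀ + T⁺r²` and `d_{t₀}(x₀, x) < A r` satisfies
`(x, t) ∈ 𝒳.pParabolicNhd (x₀, t₀) (A′ r) (T⁻r²) (T⁺r²)`, i.e.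
`d_{W₁}^{t₀−T⁻r²}(ν_{x₀,t₀;t₀−T⁻r²}, ν_{x,t;t₀−T⁻r²}) < A′ r`.
[cite: Bamler2020Entropy, §9.1, Cor. 9.6 (a) (arXiv v1 Cor. 34 (a)); §9.2, proof] -/
theorem exists_mem_pParabolicNhd_of_ricci_bound (m : ℕ) (hm : 3 ≤ m) {A K Tm Tp : ℝ}
    (hA : 0 ≤ A) (hK : 0 ≤ K) (hTm : 0 ≤ Tm) (hTp : 0 ≤ Tp) :
    ∃ A' : ℝ, 0 < A' ∧ ∀ {M : Type*} [TopologicalSpace M]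
      [ChartedSpace (EuclideanSpace ℝ (Fin m)) M]
      [IsManifold 𝓘(ℝ, EuclideanSpace ℝ (Fin m)) ∞ M] [T2Space M] [CompactSpace M]
      [SecondCountableTopology M] [MeasurableSpace M] [BorelSpace M] [ConnectedSpace M] [T3Space M]
      {h : ℝ → PseudoRiemannianMetric 𝓘(ℝ, EuclideanSpace ℝ (Fin m)) ∞ (EuclideanSpace ℝ (Fin m))
        (TangentSpace 𝓘(ℝ, EuclideanSpace ℝ (Fin m)) : M → Type _)}
      {cov : ℝ → CovariantDerivative 𝓘(ℝ, EuclideanSpace ℝ (Fin m)) (EuclideanSpace ℝ (Fin m))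
        (TangentSpace 𝓘(ℝ, EuclideanSpace ℝ (Fin m)) : M → Type _)}
      {a T : ℝ} (hflow : IsRicciFlow h cov (Icc a T)) (hh : IsContMDiffFamilyOn ∞ h univ)
      (hR : ∀ r, (h r).IsRiemannian),
      ∀ {t₀ t r : ℝ} (ht₀ : t₀ ∈ Icc a T) (ht : t ∈ Icc a T) (hb : t₀ - Tm * r ^ 2 ∈ Icc a T),
      0 < r → a < t₀ - Tm * r ^ 2 → t₀ - Tm * r ^ 2 ≤ t → t ≤ t₀ + Tp * r ^ 2 → ∀ x₀ x : M,
      (∀ s ∈ Icc (t₀ - Tm * r ^ 2) (t₀ + Tp * r ^ 2), s ≤ T → ∀ y : M,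
        (h t₀).edist (hR t₀) x₀ y < ENNReal.ofReal (2 * A * r) →
        ∀ v : TangentSpace 𝓘(ℝ, EuclideanSpace ℝ (Fin m)) y,
          |(cov s).ricci y v v| ≤ K / r ^ 2 * (h s).val y v v) →
      (h t₀).edist (hR t₀) x₀ x < ENNReal.ofReal (A * r) →
      (⟨⟨t, ht⟩, x⟩ : (ricciFlowMetricFlow hh hR Set.ordConnected_Icc hflow).Pt) ∈
        (ricciFlowMetricFlow hh hR Set.ordConnected_Icc hflow).pParabolicNhd ⟨⟨t₀, ht₀⟩, x₀⟩
          (A' * r) (Tm * r ^ 2) (Tp * r ^ 2) hb := by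
  classical
  -- the constants
  set Θ : ℝ := Tm + Tp with hΘ
  have hΘ0 : 0 ≤ Θ := add_nonneg hTm hTp
  set Hm : ℝ := MetricFlow.concentrationConst m with hHm
  rcases hA.eq_or_lt with hA0 | hA0
  · -- `A = 0`: the hypothesis `d_{t₀}(x₀, x) < 0` is void
    refine ⟨1, one_pos, ?_⟩
    intro M _ _ _ _ _ _ _ _ _ _ h cov a T hflow hh hR t₀ t r ht₀ ht hb hr _ _ _ x₀ x _ hx
    rw [← hA0, zero_mul, ENNReal.ofReal_zero] at hx
    exact absurd hx ENNReal.not_lt_zero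
  set L : ℝ := Real.exp (K * Θ) with hL
  have hL0 : 0 < L := Real.exp_pos _
  set α : ℝ := A / (L * (1 + Real.sqrt Θ)) with hα_def
  have hα : 0 < α := div_pos hA0 (mul_pos hL0 (by positivity))
  have hαL : L * α * Real.sqrt Θ < A := by
    have h1 : L * α * (1 + Real.sqrt Θ) = A := by
      rw [hα_def]; field_simp
    have h2 : 0 < L * α := mul_pos hL0 hα
    nlinarith [Real.sqrt_nonneg Θ]
  obtain ⟨C, hC, h95⟩ :=
    exists_edist_hCenter_le_of_ricci_bound m hm hα (K := K * (Θ + 1)) (by positivity)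
  set c : ℝ := (Real.sqrt Hm + C) * Real.sqrt Θ with hc
  have hc0 : 0 ≤ c := mul_nonneg (add_nonneg (Real.sqrt_nonneg _) hC.le) (Real.sqrt_nonneg _)
  set A' : ℝ := L * A + 2 * c + 1 with hA'
  have hA'0 : 0 < A' := by
    have := mul_pos hL0 hA0
    rw [hA']; linarith
  refine ⟨A', hA'0, ?_⟩
  intro M _ _ _ _ _ _ _ _ _ _ h cov a T hflow hh hR t₀ t r ht₀ ht hb hr hs₀a hs₀t htp x₀ x hRic hx
  -- notation
  set s₀ : ℝ := t₀ - Tm * r ^ 2 with hs₀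
  set 𝒳 : MetricFlow (Icc a T) := ricciFlowMetricFlow hh hR Set.ordConnected_Icc hflow with h𝒳
  have hr2 : 0 < r ^ 2 := pow_pos hr 2
  have hTmr : 0 ≤ Tm * r ^ 2 := mul_nonneg hTm hr2.le
  have hTpr : 0 ≤ Tp * r ^ 2 := mul_nonneg hTp hr2.le
  have hs₀t₀ : s₀ ≤ t₀ := by rw [hs₀]; linarith
  have hΘr : Θ * r ^ 2 = Tm * r ^ 2 + Tp * r ^ 2 := by rw [hΘ]; ring
  -- the time interval `J = [s₀, min (t₀ + T⁺ r²) T]` carrying the curvature bound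
  set s₂ : ℝ := min (t₀ + Tp * r ^ 2) T with hs₂
  have hJ : Icc s₀ s₂ ⊆ Icc a T := Icc_subset_Icc hs₀a.le (min_le_right _ _)
  have ht₀J : t₀ ∈ Icc s₀ s₂ := ⟨hs₀t₀, le_min (by linarith) ht₀.2⟩
  have htJ : t ∈ Icc s₀ s₂ := ⟨hs₀t, le_min htp ht.2⟩
  have hJΘ : s₂ - s₀ ≤ Θ * r ^ 2 := by
    have : s₂ ≤ t₀ + Tp * r ^ 2 := min_le_left _ _
    rw [hΘr, hs₀]; linarith
  have ht₀Θ : t₀ - s₀ ≤ Θ * r ^ 2 := by rw [hΘr, hs₀]; linarith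
  have htΘ : t - s₀ ≤ Θ * r ^ 2 := by rw [hΘr, hs₀]; linarith
  have hK₁ : 0 ≤ K / r ^ 2 := div_nonneg hK hr2.le
  have hkL : Real.exp (K / r ^ 2 * (s₂ - s₀)) ≤ L := by
    refine Real.exp_le_exp.2 ?_
    calc K / r ^ 2 * (s₂ - s₀) ≤ K / r ^ 2 * (Θ * r ^ 2) := mul_le_mul_of_nonneg_left hJΘ hK₁
      _ = K * Θ := by field_simp
  have hAr : 0 < A * r := mul_pos hA0 hr
  -- the curvature bound on `B_{t₀}(p, A r) × J` for `p` with `d_{t₀}(x₀, p) < A r`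
  have hRicJ : ∀ p : M, (h t₀).edist (hR t₀) x₀ p < ENNReal.ofReal (A * r) →
      ∀ τ ∈ Icc s₀ s₂, ∀ y : M, (h t₀).edist (hR t₀) p y < ENNReal.ofReal (A * r) →
        ∀ X : TangentSpace 𝓘(ℝ, EuclideanSpace ℝ (Fin m)) y,
          |(cov τ).ricci y X X| ≤ K / r ^ 2 * (h τ).val y X X := by
    intro p hp τ hτ y hy X
    refine hRic τ ⟨hτ.1, hτ.2.trans (min_le_left _ _)⟩ (hτ.2.trans (min_le_right _ _)) y ?_ X
    calc (h t₀).edist (hR t₀) x₀ y ≤ (h t₀).edist (hR t₀) x₀ p + (h t₀).edist (hR t₀) p y :=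
          (h t₀).edist_triangle (hR t₀) x₀ p y
      _ < ENNReal.ofReal (A * r) + ENNReal.ofReal (A * r) := ENNReal.add_lt_add hp hy
      _ = ENNReal.ofReal (2 * A * r) := by
          rw [← ENNReal.ofReal_add hAr.le hAr.le]; ring_nf
  have hx₀ball : (h t₀).edist (hR t₀) x₀ x₀ < ENNReal.ofReal (A * r) := by
    rw [PseudoRiemannianMetric.edist_self]; exact ENNReal.ofReal_pos.2 hAr
  -- the outer terms (Prop. 9.5 at `(x₀, t₀)` and at `(x, t)`)
  have hT1 : wassersteinW1 (𝒳.condKernel (t := ⟨t₀, ht₀⟩) x₀ ⟨s₀, hb⟩)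
      (Measure.dirac x₀ : Measure (𝒳.Slice ⟨s₀, hb⟩)) ≤ ENNReal.ofReal (c * r) :=
    wassersteinW1_condKernel_dirac_le_of_ricci_bound hm hflow hh hR hC.le hb ht₀ hs₀t₀ hΘ0 hr.le
      ht₀Θ x₀ fun hlt z hz ↦ h95 hflow hh hR hs₀a hlt ht₀.2 x₀
        (ricci_bound_parabolic_of_ricci_bound_ball hflow hR hJ ht₀J hK hr hΘ0 hJΘ hkL hα hαL x₀
          (hRicJ x₀ hx₀ball) ht₀J hlt) z hz
  have hT3 : wassersteinW1 (𝒳.condKernel (t := ⟨t, ht⟩) x ⟨s₀, hb⟩)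
      (Measure.dirac x : Measure (𝒳.Slice ⟨s₀, hb⟩)) ≤ ENNReal.ofReal (c * r) :=
    wassersteinW1_condKernel_dirac_le_of_ricci_bound hm hflow hh hR hC.le hb ht hs₀t hΘ0 hr.le
      htΘ x fun hlt z hz ↦ h95 hflow hh hR hs₀a hlt ht.2 x
        (ricci_bound_parabolic_of_ricci_bound_ball hflow hR hJ ht₀J hK hr hΘ0 hJΘ hkL hα hαL x
          (hRicJ x hx) htJ hlt) z hz
  rw [wassersteinW1_comm] at hT3
  -- the middle term: `d_{s₀}(x₀, x) ≤ L d_{t₀}(x₀, x) < L A r`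
  have hmid : @edist (𝒳.Slice ⟨s₀, hb⟩) _ x₀ x ≤ ENNReal.ofReal (L * A * r) := by
    show (h s₀).edist (hR s₀) x₀ x ≤ _
    have hx2 : (h t₀).edist (hR t₀) x₀ x < ENNReal.ofReal (2 * A * r) :=
      hx.trans_le (ENNReal.ofReal_le_ofReal (by linarith))
    have hRic2 : ∀ τ ∈ Icc s₀ s₂, ∀ y : M,
        (h t₀).edist (hR t₀) x₀ y < ENNReal.ofReal (2 * A * r) →
        ∀ X : TangentSpace 𝓘(ℝ, EuclideanSpace ℝ (Fin m)) y,
          |(cov τ).ricci y X X| ≤ K / r ^ 2 * (h τ).val y X X := fun τ hτ y hy X ↦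
      hRic τ ⟨hτ.1, hτ.2.trans (min_le_left _ _)⟩ (hτ.2.trans (min_le_right _ _)) y hy X
    have hs₀J : s₀ ∈ Icc s₀ s₂ := ⟨le_rfl, ht₀J.1.trans ht₀J.2⟩
    calc (h s₀).edist (hR s₀) x₀ x
        ≤ ENNReal.ofReal (Real.exp (K / r ^ 2 * (s₂ - s₀))) * (h t₀).edist (hR t₀) x₀ x :=
          hflow.edist_le_exp_mul_edist_of_ricci_bound_ball hR hJ hK₁ ht₀J x₀ hRic2 hs₀J hx2
      _ ≤ ENNReal.ofReal L * ENNReal.ofReal (A * r) :=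
          mul_le_mul' (ENNReal.ofReal_le_ofReal hkL) hx.le
      _ = ENNReal.ofReal (L * A * r) := by
          rw [← ENNReal.ofReal_mul hL0.le, mul_assoc]
  -- assembly
  refine MetricFlow.mem_pParabolicNhd_iff.2 ⟨⟨hs₀t, htp⟩, ?_⟩
  show wassersteinW1 (𝒳.condKernel (t := ⟨t₀, ht₀⟩) x₀ ⟨s₀, hb⟩)
    (𝒳.condKernel (t := ⟨t, ht⟩) x ⟨s₀, hb⟩) < ENNReal.ofReal (A' * r)
  haveI := 𝒳.isProbabilityMeasure_condKernel (s := ⟨s₀, hb⟩) (t := ⟨t₀, ht₀⟩) x₀ hs₀t₀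
  haveI := 𝒳.isProbabilityMeasure_condKernel (s := ⟨s₀, hb⟩) (t := ⟨t, ht⟩) x hs₀t
  have hcr : 0 ≤ c * r := mul_nonneg hc0 hr.le
  have hLAr : 0 ≤ L * A * r := by positivity
  calc wassersteinW1 (𝒳.condKernel (t := ⟨t₀, ht₀⟩) x₀ ⟨s₀, hb⟩)
        (𝒳.condKernel (t := ⟨t, ht⟩) x ⟨s₀, hb⟩)
      ≤ wassersteinW1 (𝒳.condKernel (t := ⟨t₀, ht₀⟩) x₀ ⟨s₀, hb⟩)
            (Measure.dirac x₀ : Measure (𝒳.Slice ⟨s₀, hb⟩)) +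
          wassersteinW1 (Measure.dirac x₀ : Measure (𝒳.Slice ⟨s₀, hb⟩))
            (𝒳.condKernel (t := ⟨t, ht⟩) x ⟨s₀, hb⟩) := wassersteinW1_triangle _ _ _
    _ ≤ wassersteinW1 (𝒳.condKernel (t := ⟨t₀, ht₀⟩) x₀ ⟨s₀, hb⟩)
            (Measure.dirac x₀ : Measure (𝒳.Slice ⟨s₀, hb⟩)) +
          (wassersteinW1 (Measure.dirac x₀ : Measure (𝒳.Slice ⟨s₀, hb⟩))
              (Measure.dirac x : Measure (𝒳.Slice ⟨s₀, hb⟩)) +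
            wassersteinW1 (Measure.dirac x : Measure (𝒳.Slice ⟨s₀, hb⟩))
              (𝒳.condKernel (t := ⟨t, ht⟩) x ⟨s₀, hb⟩)) :=
        add_le_add le_rfl (wassersteinW1_triangle _ _ _)
    _ ≤ ENNReal.ofReal (c * r) + (ENNReal.ofReal (L * A * r) + ENNReal.ofReal (c * r)) := by
        refine add_le_add hT1 (add_le_add ?_ hT3)
        rw [wassersteinW1_dirac_dirac]
        exact hmid
    _ = ENNReal.ofReal ((L * A + 2 * c) * r) := by
        rw [← ENNReal.ofReal_add hLAr hcr, ← ENNReal.ofReal_add hcr (add_nonneg hLAr hcr)]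
        ring_nf
    _ < ENNReal.ofReal (A' * r) := by
        refine (ENNReal.ofReal_lt_ofReal_iff (mul_pos hA'0 hr)).2 (mul_lt_mul_of_pos_right ?_ hr)
        rw [hA']
        linarith

end Literature.Geometry.Riemannian

end
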